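import Summits.QuantumFields.BalabanUV.T4Continuum.Support.B13ReadingsAvgTowerUniform

/-!
# B13ReadingsLineProductsSecond — row NE5, junction J-avg-reg SECOND ORDER (RULING R60; GAPS § G-ne5p1-Javg-reg UPDATE 1), abstract half,
# file 1: the MIXED SECOND-DIFFERENCE estimate for ordered products and the first difference of a product DIFFERENCE — the two product
# estimates the second-order factorisation induction needs beyond file 1 of g39-a

Cell `pub-balaban`, unit `b2b-balaban-t4-ne5-p1` (row NE5 OWNER, gen 39; owner item «g39-d», INTENT `HOME/CLAIMS.log` l.24783; RULING R60 l.24769;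
GAPS § G-ne5p1-Javg-reg UPDATE 1).  Summits-side NEW WORK under the LEAN PLACEMENT RULE: [folklore] normed-ring estimates (file 1 of g39-a
`B13ReadingsLineProducts` BY NAME); 0 `def`, no `Prop`-valued fact, nothing printed asserted, no citation tag.  HONEST FRAMING: rung (B)+1 of the
FINITE-VOLUME T⁴ programme — NOT infinite volume, NOT a mass gap, NOT the Clay problem, NOT a proof of NE5 (NOT PRINTED; GAPS G-t4-U3-1), NOT a
proof of NE2; nothing of Bałaban's objects here.  HONEST DEPENDENCY (cell, verbatim): continuum YM on T⁴ ⇐ BetaPertH ∧ nine spine estimates (0/9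
proved); BetaPertH ⇐ (D1) ∧ (D4) ∧ CAP+tail; G-an2-4 gates asym, D1 and NE2/3/4.

WHY.  The (ℓ2)(ℓ4) letters of NE2's bridge (`hlipD`, `hbavgD` — SECOND differences of the coefficient towers) do NOT follow from (3.35)-shape
letters (kernel witness `no_uniform_hlipD`, leaf-08, R60); they need a (3.36)-shape finest letter β″ and its PROPAGATION through the averaging
tower.  The propagation is a second-order factorisation induction; its two product estimates are: `norm_lprod_second_diff_le` — for a product
and its translates by `a`, `b`, `ab` with factors within `e` of 1, first differences `δa`, `δb` and mixed second differences `δ₂`: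
`‖Π m − Π g − Π h + Π f‖ ≤ (1+e)^n(2n²δaδb + nδ₂)` — and `norm_lprod_diff_shift_le` — the translation difference of a product DIFFERENCE
`Π f − Π g` (transporter vs straight part): `≤ (1+e)^n(2n²δρ + nρ₁)` from distances `ρ`, translation differences `δ` and distance shifts `ρ₁`.
File 2 (`B13ReadingsAvgTowerSecond`) reads them in the tower currency.  0 sorry; axioms ⊆ {propext, Classical.choice, Quot.sound}.
-/

noncomputable section

open scoped BigOperators

namespace Summit.QuantumFields.BalabanUV.T4Continuum.B13ReadingsLineProductsSecond

open Summit.QuantumFields.BalabanUV.T4Continuum.B13ReadingsLineProducts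

variable {A : Type*} [NormedRing A]

/-- [folklore] `(1 + e)^n` bounds the product of `n` factor sizes, in the `‖Π g − 1‖ + 1` form used below. -/
theorem norm_lprod_sub_one_add_one_le {g : ℕ → A} {e : ℝ} {n : ℕ} (hg : ∀ t < n, ‖g t - 1‖ ≤ e) :
    ‖lprod g n - 1‖ + 1 ≤ (1 + e) ^ n := by
  have h1 := norm_lprod_sub_one_le g n
  have h2 : ∏ t ∈ Finset.range n, (1 + ‖g t - 1‖) ≤ (1 + e) ^ n := by
    calc ∏ t ∈ Finset.range n, (1 + ‖g t - 1‖) ≤ ∏ _t ∈ Finset.range n, (1 + e) :=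
          Finset.prod_le_prod (fun t _ => by positivity) (fun t ht => add_le_add le_rfl (hg t (Finset.mem_range.1 ht)))
      _ = (1 + e) ^ n := by rw [Finset.prod_const, Finset.card_range]
  linarith

/-- [folklore] **FOURTH PRODUCT ESTIMATE — THE MIXED SECOND DIFFERENCE.**  Four factor families `f, g, h, m` (a product and its translates
by `b`, by `a`, and by both), every factor within `e` of `1`, `b`-differences `‖f_t − g_t‖, ‖h_t − m_t‖ ≤ δb`, `a`-differences
`‖f_t − h_t‖, ‖g_t − m_t‖ ≤ δa`, mixed second differences `‖m_t − g_t − h_t + f_t‖ ≤ δ₂`: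
`‖Π m − Π g − Π h + Π f‖ ≤ (1 + e)^n · (2·n²·δa·δb + n·δ₂)`.  Induction on
`Δ²P_{n+1} = (Δ²P_n)·d + (P^g − P^f)(d − b) + (P^h − P^f)(b − a) + P^h·((d − c) − (b − a))`. -/
theorem norm_lprod_second_diff_le {f g h m : ℕ → A} {e δa δb δ₂ : ℝ} {n : ℕ}
    (hf : ∀ t < n, ‖f t - 1‖ ≤ e) (hg : ∀ t < n, ‖g t - 1‖ ≤ e) (hh : ∀ t < n, ‖h t - 1‖ ≤ e) (hm : ∀ t < n, ‖m t - 1‖ ≤ e)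
    (hfg : ∀ t < n, ‖f t - g t‖ ≤ δb) (hfh : ∀ t < n, ‖f t - h t‖ ≤ δa) (hgm : ∀ t < n, ‖g t - m t‖ ≤ δa)
    (h2 : ∀ t < n, ‖m t - g t - h t + f t‖ ≤ δ₂) :
    ‖lprod m n - lprod g n - lprod h n + lprod f n‖ ≤ (1 + e) ^ n * (2 * n ^ 2 * δa * δb + n * δ₂) := by
  induction n with
  | zero => simp
  | succ n ih =>
    have res : ∀ {x : ℕ → A} {c : ℝ}, (∀ t < n + 1, ‖x t - 1‖ ≤ c) → ∀ t < n, ‖x t - 1‖ ≤ c :=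
      fun hx t ht => hx t (Nat.lt_succ_of_lt ht)
    have res2 : ∀ {x y : ℕ → A} {c : ℝ}, (∀ t < n + 1, ‖x t - y t‖ ≤ c) → ∀ t < n, ‖x t - y t‖ ≤ c :=
      fun hx t ht => hx t (Nat.lt_succ_of_lt ht)
    have hn : n < n + 1 := Nat.lt_succ_self n
    have he : 0 ≤ e := (norm_nonneg _).trans (hf n hn)
    have hδa : 0 ≤ δa := (norm_nonneg _).trans (hfh n hn)
    have hδb : 0 ≤ δb := (norm_nonneg _).trans (hfg n hn)
    have hδ₂ : 0 ≤ δ₂ := (norm_nonneg _).trans (h2 n hn)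
    have h1e : 1 ≤ 1 + e := le_add_of_nonneg_right he
    have hE := ih (res hf) (res hg) (res hh) (res hm) (res2 hfg) (res2 hfh) (res2 hgm) (fun t ht => h2 t (Nat.lt_succ_of_lt ht))
    -- first-order telescoping bounds for the partial products
    have hBA : ‖lprod g n - lprod f n‖ ≤ (1 + e) ^ n * (n * δb) := by
      calc ‖lprod g n - lprod f n‖ ≤ (1 + e) ^ n * ∑ t ∈ Finset.range n, ‖g t - f t‖ := norm_lprod_sub_lprod_le (res hg) (res hf)
        _ ≤ (1 + e) ^ n * ∑ _t ∈ Finset.range n, δb := by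
            refine mul_le_mul_of_nonneg_left (Finset.sum_le_sum fun t ht => ?_) (by positivity)
            rw [norm_sub_rev]; exact hfg t (Nat.lt_succ_of_lt (Finset.mem_range.1 ht))
        _ = (1 + e) ^ n * (n * δb) := by rw [Finset.sum_const, Finset.card_range, nsmul_eq_mul]
    have hCA : ‖lprod h n - lprod f n‖ ≤ (1 + e) ^ n * (n * δa) := by
      calc ‖lprod h n - lprod f n‖ ≤ (1 + e) ^ n * ∑ t ∈ Finset.range n, ‖h t - f t‖ := norm_lprod_sub_lprod_le (res hh) (res hf)
        _ ≤ (1 + e) ^ n * ∑ _t ∈ Finset.range n, δa := by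
            refine mul_le_mul_of_nonneg_left (Finset.sum_le_sum fun t ht => ?_) (by positivity)
            rw [norm_sub_rev]; exact hfh t (Nat.lt_succ_of_lt (Finset.mem_range.1 ht))
        _ = (1 + e) ^ n * (n * δa) := by rw [Finset.sum_const, Finset.card_range, nsmul_eq_mul]
    have hC1 : ‖lprod h n - 1‖ + 1 ≤ (1 + e) ^ n := norm_lprod_sub_one_add_one_le (res hh)
    set Aₙ := lprod f n; set Bₙ := lprod g n; set Cₙ := lprod h n; set Dₙ := lprod m n
    rw [lprod_succ, lprod_succ, lprod_succ, lprod_succ]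
    have key : Dₙ * m n - Bₙ * g n - Cₙ * h n + Aₙ * f n
        = ((Dₙ - Bₙ - Cₙ + Aₙ) * (m n - 1) + (Dₙ - Bₙ - Cₙ + Aₙ)) + (Bₙ - Aₙ) * (m n - g n) + (Cₙ - Aₙ) * (g n - f n)
          + ((Cₙ - 1) * (m n - h n - (g n - f n)) + (m n - h n - (g n - f n))) := by noncomm_ring
    rw [key]
    have hmg : ‖m n - g n‖ ≤ δa := by rw [norm_sub_rev]; exact hgm n hn
    have hgf : ‖g n - f n‖ ≤ δb := by rw [norm_sub_rev]; exact hfg n hn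
    have h2n : ‖m n - h n - (g n - f n)‖ ≤ δ₂ := by
      have : m n - h n - (g n - f n) = m n - g n - h n + f n := by abel
      rw [this]; exact h2 n hn
    calc ‖((Dₙ - Bₙ - Cₙ + Aₙ) * (m n - 1) + (Dₙ - Bₙ - Cₙ + Aₙ)) + (Bₙ - Aₙ) * (m n - g n) + (Cₙ - Aₙ) * (g n - f n)
          + ((Cₙ - 1) * (m n - h n - (g n - f n)) + (m n - h n - (g n - f n)))‖
        ≤ (‖Dₙ - Bₙ - Cₙ + Aₙ‖ * ‖m n - 1‖ + ‖Dₙ - Bₙ - Cₙ + Aₙ‖) + ‖Bₙ - Aₙ‖ * ‖m n - g n‖ + ‖Cₙ - Aₙ‖ * ‖g n - f n‖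
          + (‖Cₙ - 1‖ * ‖m n - h n - (g n - f n)‖ + ‖m n - h n - (g n - f n)‖) := by
          refine (norm_add_le _ _).trans (add_le_add ((norm_add_le _ _).trans (add_le_add ((norm_add_le _ _).trans
            (add_le_add ((norm_add_le _ _).trans (add_le_add (norm_mul_le _ _) le_rfl)) (norm_mul_le _ _))) (norm_mul_le _ _))) ?_)
          exact (norm_add_le _ _).trans (add_le_add (norm_mul_le _ _) le_rfl)
      _ = ‖Dₙ - Bₙ - Cₙ + Aₙ‖ * (‖m n - 1‖ + 1) + ‖Bₙ - Aₙ‖ * ‖m n - g n‖ + ‖Cₙ - Aₙ‖ * ‖g n - f n‖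
          + (‖Cₙ - 1‖ + 1) * ‖m n - h n - (g n - f n)‖ := by ring
      _ ≤ ((1 + e) ^ n * (2 * n ^ 2 * δa * δb + n * δ₂)) * (e + 1) + ((1 + e) ^ n * (n * δb)) * δa + ((1 + e) ^ n * (n * δa)) * δb
          + (1 + e) ^ n * δ₂ := by
          gcongr
          · exact hm n hn
      _ = (1 + e) ^ n * ((1 + e) * (2 * n ^ 2 * δa * δb + n * δ₂) + (2 * n * δa * δb + δ₂)) := by ring
      _ ≤ (1 + e) ^ n * ((1 + e) * (2 * n ^ 2 * δa * δb + n * δ₂) + (1 + e) * (2 * n * δa * δb + δ₂)) := by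
          gcongr
          exact le_mul_of_one_le_left (by positivity) h1e
      _ = (1 + e) ^ (n + 1) * (2 * (n ^ 2 + n) * δa * δb + (n + 1) * δ₂) := by ring
      _ ≤ (1 + e) ^ (n + 1) * (2 * ((n : ℝ) + 1) ^ 2 * δa * δb + (n + 1) * δ₂) := by
          gcongr
          nlinarith
      _ = (1 + e) ^ (n + 1) * (2 * ((n + 1 : ℕ) : ℝ) ^ 2 * δa * δb + ((n + 1 : ℕ) : ℝ) * δ₂) := by push_cast; ring

/-- [folklore] **FIFTH PRODUCT ESTIMATE — THE FIRST DIFFERENCE OF A PRODUCT DIFFERENCE.**  Two products `Π f`, `Π g` (think: transporters and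
their straight parts) and their translates `Π f′`, `Π g′`; every factor within `e` of `1`; distances `‖f_t − g_t‖, ‖f′_t − g′_t‖ ≤ ρ`;
translation differences `‖f_t − f′_t‖, ‖g_t − g′_t‖ ≤ δ`; and the translation difference OF THE DISTANCE `‖(f′_t − g′_t) − (f_t − g_t)‖ ≤ ρ₁`:
`‖(Π f′ − Π g′) − (Π f − Π g)‖ ≤ (1 + e)^n · (2·n²·δ·ρ + n·ρ₁)` — the mixed estimate with the roles (translate, pass to the straight part). -/
theorem norm_lprod_diff_shift_le {f g f' g' : ℕ → A} {e δ ρ ρ₁ : ℝ} {n : ℕ}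
    (hf : ∀ t < n, ‖f t - 1‖ ≤ e) (hg : ∀ t < n, ‖g t - 1‖ ≤ e) (hf' : ∀ t < n, ‖f' t - 1‖ ≤ e) (hg' : ∀ t < n, ‖g' t - 1‖ ≤ e)
    (hfg : ∀ t < n, ‖f t - g t‖ ≤ ρ) (hff' : ∀ t < n, ‖f t - f' t‖ ≤ δ) (hgg' : ∀ t < n, ‖g t - g' t‖ ≤ δ)
    (h2 : ∀ t < n, ‖f' t - g' t - f t + g t‖ ≤ ρ₁) :
    ‖lprod f' n - lprod g' n - lprod f n + lprod g n‖ ≤ (1 + e) ^ n * (2 * n ^ 2 * δ * ρ + n * ρ₁) := by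
  -- the mixed estimate with `(f, g, h, m) := (g, f, g′, f′)`: `b`-direction = «straight → transporter» (ρ), `a`-direction = translation (δ)
  have h := norm_lprod_second_diff_le (f := g) (g := f) (h := g') (m := f') hg hf hg' hf'
    (fun t ht => by rw [norm_sub_rev]; exact hfg t ht) hgg' hff' (fun t ht => by
      have : f' t - f t - g' t + g t = f' t - g' t - f t + g t := by abel
      rw [this]; exact h2 t ht)
  have e1 : lprod f' n - lprod f n - lprod g' n + lprod g n = lprod f' n - lprod g' n - lprod f n + lprod g n := by abel
  rw [e1] at h
  exact h

end Summit.QuantumFields.BalabanUV.T4Continuum.B13ReadingsLineProductsSecond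

end
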